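import Summits.CriticalPhenomena.PercolationContinuityZ3.Theorems.Transplant.SkelNeg1ParamsL
import HarnessLib

/-!
# N1 params, chain of record `NegB` (the `Neg` chain RE-VERSIONED ONCE with a BOX slot), part L: the long box **`NegB.ML κ Φ t p D g := max (Neg.ML …) g`**, the long width
# `NegB.nL κ Φ t p D g f`, the long data `hL/ℓL/vL/vβL`, the multipliers `m0/m1`, the pair list `SMn g f` — every landed floor of `Neg.ML` transferred (`Neg.ML ≤ NegB.ML g`)

builds on p205010 (kernel theorem, internal audit signed; external expert review pending) — nothing in this file uses p205010; NOTHING is claimed about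
the node `SamePDropOfSkeletonNeg₁` (OPEN).
Status sentence (coordinator 2026-08-20T04:30Z): "θ(p_c) = 0 on ℤ^d, all d ≥ 2 — kernel-verified (Lean 4/Mathlib, standard axioms); internal adversarial
audit SIGNED 2026-08-20 04:29Z; external expert review pending."
Lane `prim-bschramm-*`, seat `prim-bschramm-stmt` (gen 13); helper file (`--supports stmt-CriticalPhenomena-4575 --as helper`); ledger HOME/prim-bschramm-stmt/NEG-PARAMS.md v0.10.
WHY THE RE-VERSION (located, stmt-g13 2026-08-21T15:45:24Z): the (R) ruling N1-R-PLAN v2 / B.13 (p3-g9 15:38:39Z) adds a third Step-I″ pair `(M_b, n_b)` (the BRIDGE) chosen AFTER the kit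
block, and the long box must dominate the bridge parallelogram: `M_L + 1 ≥ 2C′(n_b + ℓ_b + |h_b|) + 1` — a BOX floor with data the landed `Neg.ML` (short data only, no slot) cannot see.
So the chain of record is re-typed in the namespace `NegB` with TWO slots: `g` (extra BOX floors: the bridge's, the kit layer's) and `f` (extra WIDTH floors: (R-F1)_b, `C_run·R′`);
every value and fact holds for EVERY `(g, f)`, and the ledger closes both slots at the end (`NegB.gR`, `NegB.fR`).  The `Neg` one-slot chain (p277618 …) stays as the `g = 0` reading.
Names: the SAME short names as `Neg` (`ML nL hL ℓL vL vβL m0 m1 SMn …`), one more argument `g`; the zone scale / short pair / kit block (`Mu ρz nS hS ℓS vS As Mk T₀ … Rlev R'`,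
`Sz`, `m₀`) are `Neg`'s unchanged (no box dependence).
* §1 `ML`, `ML_le_ML` (`Neg.ML ≤ ML g`, `g ≤ ML g`), `Mu_le_ML`, `nS_le_ML`, `hop_floor_le_ML`, `slack_floor_le_ML`, `coarse_floor_le_ML`, `kit_floors_ML` (the landed floors, transferred);
* §2 `nL g f`, `hL/ℓL/vL/vβL/m0/m1`, `SMn g f`; §3 `n₁L_le_nL`, `ML_lt_nL`, `nS_lt_nL`, `mem_SMn`, `SMn_adm_at`.
[cite: KozmaNitzan2024, §4 Theorem 6 (pp. 25–31): the order of constants] [cite: MartineauTassion2017, §3.2 Lemma 3.5, §4.1–4.3]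
-/

noncomputable section

open scoped Classical

namespace Summit.CriticalPhenomena.PercolationContinuityZ3.Theorems.Transplant

namespace PlanarSkeletonNeg

namespace NegB

open Literature.Probability.Percolation Literature.Probability.LatticeModels SimpleGraph
open SkelConc (Consts)
open Neg

section LLevel

variable (κ : Consts) {V : Type} [DecidableEq V] [Countable V] {G : SimpleGraph V} [G.LocallyFinite] (Φ : PlanarSkeletonNeg G) (t : V)
  (p : unitInterval) (D : Skelφ.StepI.DataN V) (g f : ℕ)

/-! ## §1 The long box with the box slot -/

/-- **THE LONG BOX OF RECORD with floor slot `g`**: `M_L := max (Neg.ML κ Φ t p D) g` (`Neg.ML` = the v0 floors `{M_u, 16(|h_s|+ℓ_s+n_s), 959, 4K(R′+2)}`; `g` = the box floors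
posted later: the bridge's `16(n_b + ℓ_b + |h_b|)`, the kit layer's). [this work] -/
def ML : ℕ := max (Neg.ML κ Φ t p D) g

/-- `Neg.ML ≤ M_L` and `g ≤ M_L`. [folklore] -/
theorem ML_le_ML : Neg.ML κ Φ t p D ≤ ML κ Φ t p D g ∧ g ≤ ML κ Φ t p D g := ⟨le_max_left _ _, le_max_right _ _⟩

/-- `M_u ≤ M_L`. [folklore] -/
theorem Mu_le_ML : Mu D ≤ ML κ Φ t p D g := (Neg.Mu_le_ML κ Φ t p D).trans (ML_le_ML κ Φ t p D g).1

/-- `n_s ≤ M_L`. [folklore] -/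
theorem nS_le_ML : nS D ≤ ML κ Φ t p D g := (Neg.nS_le_ML κ Φ t p D).trans (ML_le_ML κ Φ t p D g).1

/-- D4's hop floor `2C′(|h_s|+ℓ_s+n_s) ≤ M_L`. [folklore] -/
theorem hop_floor_le_ML : 2 * Neg.C' * ((hS t D).natAbs + ℓS t D + nS D) ≤ ML κ Φ t p D g :=
  (Neg.hop_floor_le_ML κ Φ t p D).trans (ML_le_ML κ Φ t p D g).1

/-- The slack floor `960 ≤ M_L + 1`. [folklore] -/
theorem slack_floor_le_ML : 960 ≤ ML κ Φ t p D g + 1 := by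
  have h1 := Neg.slack_floor_le_ML κ Φ t p D
  have h2 := (ML_le_ML κ Φ t p D g).1
  omega

/-- The coarse/kit floors `4K(R′+2) ≤ M_L`, `4K ≤ M_L`. [folklore] -/
theorem coarse_floor_le_ML : 4 * Neg.K κ * (R' κ Φ t p D + 2) ≤ ML κ Φ t p D g ∧ 4 * Neg.K κ ≤ ML κ Φ t p D g :=
  ⟨(Neg.coarse_floor_le_ML κ Φ t p D).1.trans (ML_le_ML κ Φ t p D g).1, (Neg.coarse_floor_le_ML κ Φ t p D).2.trans (ML_le_ML κ Φ t p D g).1⟩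

/-- `4K·R′ + 2 ≤ M_L`, `4K + 2 ≤ M_L`, `8K + 2 ≤ M_L`. [folklore] -/
theorem kit_floors_ML : 4 * Neg.K κ * R' κ Φ t p D + 2 ≤ ML κ Φ t p D g ∧ 4 * Neg.K κ + 2 ≤ ML κ Φ t p D g ∧ 8 * Neg.K κ + 2 ≤ ML κ Φ t p D g := by
  obtain ⟨h1, h2, h3⟩ := Neg.kit_floors_ML κ Φ t p D
  have h := (ML_le_ML κ Φ t p D g).1
  exact ⟨h1.trans h, h2.trans h, h3.trans h⟩

/-! ## §2 The long width, data, multipliers, list -/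

/-- **The long width with box slot `g` and clearance slot `f`**: `n_L := max {D.n₁ M_L, f, M_L + 1, K(R′+2)}`. [this work] -/
def nL : ℕ := Skelφ.NegPrm.nL (max (D.n₁ (ML κ Φ t p D g)) f) (ML κ Φ t p D g) (Neg.K κ) (R' κ Φ t p D)

/-- The long shear `h_L := D.hgt t M_L n_L`. [this work] -/
def hL : ℤ := D.hgt t (ML κ Φ t p D g) (nL κ Φ t p D g f)

/-- The long half-length `ℓ_L := D.len t M_L n_L`. [this work] -/
def ℓL : ℕ := D.len t (ML κ Φ t p D g) (nL κ Φ t p D g f)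

/-- The long split point `v_L := D.spl t M_L n_L`. [this work] -/
def vL : ℤ := D.spl t (ML κ Φ t p D g) (nL κ Φ t p D g f)

/-- The second lattice vector's height `v_β := vβOf n_L h_L ℓ_L v_L`. [this work] -/
def vβL : ℤ := Skelφ.NegPrm.vβOf (nL κ Φ t p D g f) (hL κ Φ t p D g f) (ℓL κ Φ t p D g f) (vL κ Φ t p D g f)

/-- The maximal fine multiplier of axis `0`: `m₀ := mOf₀ K n_L h_L ℓ_L v_L`. [this work] -/
def m0 : ℤ := Skelφ.NegPrm.mOf₀ (Neg.K κ) (nL κ Φ t p D g f) (hL κ Φ t p D g f) (ℓL κ Φ t p D g f) (vL κ Φ t p D g f)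

/-- The maximal fine multiplier of axis `1`: `m₁ := mOf₁ K n_L h_L ℓ_L v_L`. [this work] -/
def m1 : ℤ := Skelφ.NegPrm.mOf₁ (Neg.K κ) (nL κ Φ t p D g f) (hL κ Φ t p D g f) (ℓL κ Φ t p D g f) (vL κ Φ t p D g f)

/-- **The two ledger pairs** `SMn := {(M_u, n_s), (M_L, n_L)}`. [this work] -/
def SMn : Finset (ℕ × ℕ) := Skelφ.NegPrm.SMn (Mu D) (nS D) (ML κ Φ t p D g) (nL κ Φ t p D g f)

/-! ## §3 The facts by name -/

/-- `D.n₁ M_L ≤ n_L` and `f ≤ n_L`. [folklore] -/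
theorem n₁L_le_nL : D.n₁ (ML κ Φ t p D g) ≤ nL κ Φ t p D g f ∧ f ≤ nL κ Φ t p D g f := Skelφ.NegPrm.rootClear_le_nL _ f _ _ _

/-- `M_L < n_L` and `K(R′+2) ≤ n_L`. [folklore] -/
theorem ML_lt_nL : ML κ Φ t p D g < nL κ Φ t p D g f ∧ Neg.K κ * (R' κ Φ t p D + 2) ≤ nL κ Φ t p D g f :=
  ⟨Skelφ.NegPrm.ML_lt_nL _ _ _ _, Skelφ.NegPrm.coarse_floor_le_nL _ _ _ _⟩

/-- `n_s < n_L`. [folklore] -/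
theorem nS_lt_nL : nS D < nL κ Φ t p D g f := lt_of_le_of_lt (nS_le_ML κ Φ t p D g) (ML_lt_nL κ Φ t p D g f).1

/-- The two pairs are listed. [folklore] -/
theorem mem_SMn : (Mu D, nS D) ∈ SMn κ Φ t p D g f ∧ (ML κ Φ t p D g, nL κ Φ t p D g f) ∈ SMn κ Φ t p D g f :=
  ⟨Skelφ.NegPrm.short_mem_SMn _ _ _ _, Skelφ.NegPrm.long_mem_SMn _ _ _ _⟩

/-- **Pair admissibility**: `∀ q ∈ SMn, D.M₀ ≤ q.1 ∧ D.n₁ q.1 ≤ q.2` — for every `(g, f)`. [folklore] -/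
theorem SMn_adm_at : ∀ q ∈ SMn κ Φ t p D g f, D.M₀ ≤ q.1 ∧ D.n₁ q.1 ≤ q.2 :=
  Skelφ.NegPrm.SMn_adm (M₀_le_Mu D) (n₁_le_nS D) ((M₀_le_Mu D).trans (Mu_le_ML κ Φ t p D g)) (n₁L_le_nL κ Φ t p D g f).1

end LLevel

end NegB

end PlanarSkeletonNeg

end Summit.CriticalPhenomena.PercolationContinuityZ3.Theorems.Transplant

end
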